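import Mathlib.Topology.Instances.ENNReal.Lemmas
import Mathlib.Algebra.Order.BigOperators.Group.Finset
import HarnessLib

/-!
# Route `BECRieszReverseHolder`, crux `CoarseGrainedReverseHolder`
# (stmt-AtomisticToContinuum-12840), line `registered`: stub `stub_sqSumDivLipschitz` (S1a)

Supports (does not close) stmt-AtomisticToContinuum-12840; stub `stub_sqSumDivLipschitz` of the line
`registered` (`Cruxes/CoarseGrainedReverseHolder/Lines/registered.lean`).

**The finite-dimensional core of the `L²`-Lipschitz estimate of the coarse-grained reverse-Hölder
functional.** For a finite index type `ι`, families `a b : ι → ℝ≥0∞` and masses `A, B` with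
`Σ a ≤ A`, `Σ b ≤ B`:

`(Σ_k a_k²) / A ≤ (Σ_k b_k²) / B + (2 Σ_k (a_k ∸ b_k) + (B ∸ A))`

with the `ℝ≥0∞` conventions `0/0 = 0`, `x/⊤ = 0`, truncated subtraction.  The proof is the
`min`-route, entirely inside `ℝ≥0∞` (no passage to `ℝ`): with `c_k := min a_k b_k` one has
`a_k = c_k + (a_k ∸ b_k)`, `c_k ≤ a_k ≤ A`, `c_k ≤ b_k ≤ B`, and

1. `Σ a² / A = (Σ a c + Σ a (a ∸ b)) / A ≤ Σ a c / A + Σ (a ∸ b)` (`a_k x / A ≤ x` from `a_k ≤ A`);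
2. `Σ a c / A = (Σ c² + Σ c (a ∸ b)) / A ≤ Σ c² / A + Σ (a ∸ b)` (`c_k ≤ A`);
3. `Σ c² / A ≤ Σ c² / B + (B ∸ A)`, because `S := Σ c² ≤ (Σ a) · B ≤ A B`: if `B ≤ A` division is
   antitone in the denominator; if `A < B = ⊤` the right side is `⊤`; if `A < B < ⊤` then
   `S = (S/B) B = (S/B) A + (S/B)(B − A) ≤ A (S/B + (B − A))` using `S/B ≤ A`;
4. `Σ c² / B ≤ Σ b² / B` (`c ≤ b`).

Mathlib only (`ENNReal.div_le_of_le_mul`, `ENNReal.div_le_div_left/right`, `ENNReal.add_div`,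
`ENNReal.div_mul_cancel`, `tsub_add_min`, `add_tsub_cancel_of_le`, `Finset.sum_mul`).
-/

noncomputable section

open scoped ENNReal BigOperators

namespace Summit.AtomisticToContinuum.BoseEinsteinCondensation.Theorems.CoarseGrainedReverseHolder

namespace SqSumDivLipschitz

/-- If `a ≤ A` in `ℝ≥0∞` then `a x / A ≤ x` for every `x` (all conventions included: for `A = 0`
the numerator vanishes, for `A = ⊤` the quotient vanishes). -/
theorem mul_div_le_of_le {a A : ℝ≥0∞} (h : a ≤ A) (x : ℝ≥0∞) : a * x / A ≤ x :=
  ENNReal.div_le_of_le_mul' (mul_le_mul' h le_rfl)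

/-- Summed form of `mul_div_le_of_le`: if every `a k ≤ A` then `(Σ_k a_k x_k) / A ≤ Σ_k x_k`. -/
theorem sum_mul_div_le {ι : Type*} (s : Finset ι) {a : ι → ℝ≥0∞} {A : ℝ≥0∞}
    (h : ∀ k, a k ≤ A) (x : ι → ℝ≥0∞) :
    (∑ k ∈ s, a k * x k) / A ≤ ∑ k ∈ s, x k := by
  rw [div_eq_mul_inv, Finset.sum_mul]
  exact Finset.sum_le_sum fun k _ => mul_div_le_of_le (h k) (x k)

/-- The denominator-exchange step: if `S ≤ A B` in `ℝ≥0∞` then `S / A ≤ S / B + (B ∸ A)`. -/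
theorem div_le_div_add_tsub {S A B : ℝ≥0∞} (h : S ≤ A * B) : S / A ≤ S / B + (B - A) := by
  rcases le_or_gt B A with hBA | hAB
  · exact (ENNReal.div_le_div_left hBA S).trans le_self_add
  · rcases eq_or_ne B ⊤ with rfl | hB
    · rw [ENNReal.top_sub hAB.ne_top, add_top]
      exact le_top
    · have hB0 : B ≠ 0 := (zero_le.trans_lt hAB).ne'
      have hSB : S / B ≤ A := ENNReal.div_le_of_le_mul h
      refine ENNReal.div_le_of_le_mul' ?_
      calc S = S / B * B := (ENNReal.div_mul_cancel hB0 hB).symm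
        _ = S / B * A + S / B * (B - A) := by rw [← mul_add, add_tsub_cancel_of_le hAB.le]
        _ ≤ S / B * A + A * (B - A) := add_le_add le_rfl (mul_le_mul' hSB le_rfl)
        _ = A * (S / B + (B - A)) := by rw [mul_add, mul_comm]

end SqSumDivLipschitz

open SqSumDivLipschitz in
/-- **Stub `stub_sqSumDivLipschitz` (S1a) of the line `registered` — the finite-dimensional
Lipschitz estimate.** For finite families `a, b : ι → ℝ≥0∞` with `Σ a ≤ A`, `Σ b ≤ B`:
`Σ a²/A ≤ Σ b²/B + (2 Σₖ (aₖ ∸ bₖ) + (B ∸ A))` (`ℝ≥0∞` conventions `0/0 = 0`, `x/⊤ = 0`, truncated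
subtraction).  `min`-route with `cₖ = min aₖ bₖ`, `aₖ = cₖ + (aₖ ∸ bₖ)`:
`Σa²/A ≤ Σac/A + Σ(a∸b) ≤ Σc²/A + 2Σ(a∸b) ≤ Σc²/B + (B∸A) + 2Σ(a∸b) ≤ Σb²/B + (B∸A) + 2Σ(a∸b)`,
the third step from `Σ c² ≤ (Σ a) B ≤ A B` (`div_le_div_add_tsub`). -/
theorem stub_sqSumDivLipschitz :
    ∀ (ι : Type) [Fintype ι] (a b : ι → ENNReal) (A B : ENNReal),
      ∑ k, a k ≤ A → ∑ k, b k ≤ B →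
      (∑ k, a k ^ 2) / A ≤ (∑ k, b k ^ 2) / B + (2 * ∑ k, (a k - b k) + (B - A)) := by
  intro ι _ a b A B hA hB
  -- `c k = min (a k) (b k)`, used only through `c ≤ a`, `c ≤ b`, `c + (a ∸ b) = a`.
  obtain ⟨c, hca, hcb, hdec⟩ : ∃ c : ι → ℝ≥0∞,
      (∀ k, c k ≤ a k) ∧ (∀ k, c k ≤ b k) ∧ ∀ k, c k + (a k - b k) = a k :=
    ⟨fun k => min (a k) (b k), fun k => min_le_left _ _, fun k => min_le_right _ _,
      fun k => (add_comm _ _).trans tsub_add_min⟩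
  have hak : ∀ k, a k ≤ A := fun k =>
    (Finset.single_le_sum (fun i _ => (zero_le : (0 : ℝ≥0∞) ≤ a i)) (Finset.mem_univ k)).trans hA
  have hbk : ∀ k, b k ≤ B := fun k =>
    (Finset.single_le_sum (fun i _ => (zero_le : (0 : ℝ≥0∞) ≤ b i)) (Finset.mem_univ k)).trans hB
  have hcA : ∀ k, c k ≤ A := fun k => (hca k).trans (hak k)
  -- Step 1: `Σ a² / A ≤ Σ a c / A + Σ (a ∸ b)`.
  have h1 : (∑ k, a k ^ 2) / A ≤ (∑ k, a k * c k) / A + ∑ k, (a k - b k) := by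
    calc (∑ k, a k ^ 2) / A = (∑ k, a k * c k + ∑ k, a k * (a k - b k)) / A := by
          rw [← Finset.sum_add_distrib]
          refine congrArg (· / A) (Finset.sum_congr rfl fun k _ => ?_)
          rw [← mul_add, hdec, sq]
      _ = (∑ k, a k * c k) / A + (∑ k, a k * (a k - b k)) / A := ENNReal.add_div
      _ ≤ (∑ k, a k * c k) / A + ∑ k, (a k - b k) :=
          add_le_add le_rfl (sum_mul_div_le Finset.univ hak fun k => a k - b k)
  -- Step 2: `Σ a c / A ≤ Σ c² / A + Σ (a ∸ b)`.
  have h2 : (∑ k, a k * c k) / A ≤ (∑ k, c k ^ 2) / A + ∑ k, (a k - b k) := by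
    calc (∑ k, a k * c k) / A = (∑ k, c k ^ 2 + ∑ k, c k * (a k - b k)) / A := by
          rw [← Finset.sum_add_distrib]
          refine congrArg (· / A) (Finset.sum_congr rfl fun k _ => ?_)
          rw [sq, ← mul_add, hdec, mul_comm]
      _ = (∑ k, c k ^ 2) / A + (∑ k, c k * (a k - b k)) / A := ENNReal.add_div
      _ ≤ (∑ k, c k ^ 2) / A + ∑ k, (a k - b k) :=
          add_le_add le_rfl (sum_mul_div_le Finset.univ hcA fun k => a k - b k)
  -- Step 3: `Σ c² ≤ A B`, hence `Σ c² / A ≤ Σ c² / B + (B ∸ A)`.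
  have hS : ∑ k, c k ^ 2 ≤ A * B := by
    calc ∑ k, c k ^ 2 ≤ ∑ k, a k * B := Finset.sum_le_sum fun k _ => by
            rw [sq]
            exact mul_le_mul' (hca k) ((hcb k).trans (hbk k))
      _ = (∑ k, a k) * B := (Finset.sum_mul Finset.univ a B).symm
      _ ≤ A * B := mul_le_mul' hA le_rfl
  have h3 : (∑ k, c k ^ 2) / A ≤ (∑ k, c k ^ 2) / B + (B - A) := div_le_div_add_tsub hS
  -- Step 4: `Σ c² / B ≤ Σ b² / B`.
  have h4 : (∑ k, c k ^ 2) / B ≤ (∑ k, b k ^ 2) / B :=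
    ENNReal.div_le_div_right (Finset.sum_le_sum fun k _ => by
      rw [sq, sq]
      exact mul_le_mul' (hcb k) (hcb k)) B
  -- Combine.
  calc (∑ k, a k ^ 2) / A
      ≤ (∑ k, b k ^ 2) / B + (B - A) + ∑ k, (a k - b k) + ∑ k, (a k - b k) :=
        h1.trans (add_le_add (h2.trans (add_le_add (h3.trans (add_le_add h4 le_rfl)) le_rfl))
          le_rfl)
    _ = (∑ k, b k ^ 2) / B + (2 * ∑ k, (a k - b k) + (B - A)) := by
        rw [two_mul, add_assoc, add_assoc, add_comm (B - A)]
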